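import Mathlib.Analysis.SpecialFunctions.Exponential
import Mathlib.Analysis.SpecialFunctions.ExpDeriv
import Mathlib.Analysis.Calculus.FDeriv.Symmetric
import Mathlib.Analysis.Calculus.FDeriv.Mul
import Mathlib.Analysis.Calculus.ContDiff.Basic
import Mathlib.Analysis.Calculus.Deriv.Comp
import Mathlib.Analysis.Calculus.MeanValue
import HarnessLib

/-!
# Venture YMGap — multi-link Bakry–Émery calculus, Part B:
# left-invariant derivatives on a complete normed algebra

HONEST FRAMING: venture file (cell `pub-ymgap`, track (a), seat p2). General calculus plumbing
towards a KERNEL proof of the multi-link Bakry–Émery Poincaré inequality for lattice `SU(N)`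
Yang–Mills (the Poincaré half of Shen–Zhu–Zhu's Cor. 4.5 at the sharp window `|β| < 1/(8d)`);
no physics and no new mathematics in this file.

First file of the MULTI-LINK (lattice) version of the tree's one-link Bakry–Émery development
`SUNBakryEmeryPoincare.lean` (which proves the Poincaré inequality for Gibbs-tilted Haar measures
on a single `SU(N)`). The lattice configuration space `SU(N)^E` sits inside the product algebra
`𝔸 = (E → M_N(ℂ))`, and the left-invariant derivative in the link `e` in the direction `Y ∈ 𝔰𝔲(N)`
is `D_{(e,Y)} F(Q) = d/dt F(Q · exp(t · single_e Y))|₀ = dF(Q)[Q · single_e Y]` — i.e. the SAME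
formula `D_A F(Q) = dF(Q)[Q A]` as for one link, now in the algebra `𝔸` with `A = single_e Y`.
This file therefore develops `D_A F(Q) := dF(Q)[Q A]` (`algD`) once and for all for an ARBITRARY
complete normed real algebra `𝔸` (Leibniz and chain rules, linearity in the direction, the
commutator identity `[D_A, D_B] = D_{[A,B]}` from the symmetry of second derivatives, and the flow
identity `d/dt F(Q e^{tA}) = (D_A F)(Q e^{tA})`); the proofs are those of
`SUNBakryEmeryPoincare.lean` Part B verbatim, minus the matrix-specific topology bookkeeping.

Not here: anything specific to `SU(N)`, frames, the carré du champ (next files).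

## References

* D. Bakry, I. Gentil, M. Ledoux, *Analysis and Geometry of Markov Diffusion Operators*,
  Grundlehren 348 (2014), §1.16 (left-invariant vector fields and diffusion operators on Lie
  groups). The tree file `SUNBakryEmeryPoincare.lean`, Part B.
-/

noncomputable section

open scoped ContDiff Topology

namespace Summit.Ventures.YMGap

namespace LatticeBakryEmery

variable {𝔸 : Type*} [NormedRing 𝔸] [NormedAlgebra ℝ 𝔸]

/-! ### The left-invariant derivative `D_A F(Q) = dF(Q)[Q A]` -/

/-- The **left-invariant derivative** `(D_A F)(Q) = dF(Q)[Q A] = d/dt F(Q e^{tA})|_{t=0}` of a real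
function on a complete normed real algebra `𝔸`, in the direction of the left-invariant vector
field generated by `A` (for `𝔸 = M_N(ℂ)` this is `SUNBakryEmery.matD`; for the product algebra
`E → M_N(ℂ)` and `A = single_e Y` it is the derivative in the link `e`). [folklore] -/
def algD (A : 𝔸) (F : 𝔸 → ℝ) : 𝔸 → ℝ :=
  fun Q => fderiv ℝ F Q (Q * A)

/-- Unfolding `algD`. [folklore] -/
theorem algD_apply (A : 𝔸) (F : 𝔸 → ℝ) (Q : 𝔸) : algD A F Q = fderiv ℝ F Q (Q * A) := rfl

/-- `D_A` preserves smoothness. [folklore] -/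
theorem contDiff_algD {F : 𝔸 → ℝ} (hF : ContDiff ℝ ∞ F) (A : 𝔸) : ContDiff ℝ ∞ (algD A F) := by
  have h1 : ContDiff ℝ ∞ (fderiv ℝ F) := hF.fderiv_right (m := ∞) le_rfl
  exact h1.clm_apply (contDiff_id.mul contDiff_const)

/-! #### Linearity in the function -/

/-- `D_A (F + G) = D_A F + D_A G`. [folklore] -/
theorem algD_add {F G : 𝔸 → ℝ} (hF : ContDiff ℝ ∞ F) (hG : ContDiff ℝ ∞ G) (A : 𝔸) :
    algD A (F + G) = algD A F + algD A G := by
  funext Q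
  have hFd : DifferentiableAt ℝ F Q := hF.differentiable (by simp) Q
  have hGd : DifferentiableAt ℝ G Q := hG.differentiable (by simp) Q
  simp only [algD, Pi.add_apply]
  rw [fderiv_add hFd hGd]
  rfl

/-- `D_A (F - G) = D_A F - D_A G`. [folklore] -/
theorem algD_sub {F G : 𝔸 → ℝ} (hF : ContDiff ℝ ∞ F) (hG : ContDiff ℝ ∞ G) (A : 𝔸) :
    algD A (F - G) = algD A F - algD A G := by
  funext Q
  have hFd : DifferentiableAt ℝ F Q := hF.differentiable (by simp) Q
  have hGd : DifferentiableAt ℝ G Q := hG.differentiable (by simp) Q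
  simp only [algD, Pi.sub_apply]
  rw [fderiv_sub hFd hGd]
  rfl

/-- `D_A (c F) = c D_A F`. [folklore] -/
theorem algD_const_mul {F : 𝔸 → ℝ} (hF : ContDiff ℝ ∞ F) (c : ℝ) (A : 𝔸) :
    algD A (fun Q => c * F Q) = fun Q => c * algD A F Q := by
  funext Q
  have hFd : DifferentiableAt ℝ F Q := hF.differentiable (by simp) Q
  simp only [algD]
  rw [fderiv_const_mul hFd]
  rfl

/-- `D_A c = 0`. [folklore] -/
theorem algD_const (c : ℝ) (A : 𝔸) : algD A (fun _ : 𝔸 => c) = 0 := by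
  funext Q
  simp [algD]

/-- `D_A (∑ᵢ Fᵢ) = ∑ᵢ D_A Fᵢ`. [folklore] -/
theorem algD_sum {κ : Type*} (s : Finset κ) {F : κ → 𝔸 → ℝ} (hF : ∀ i ∈ s, ContDiff ℝ ∞ (F i)) (A : 𝔸) :
    algD A (fun Q => ∑ i ∈ s, F i Q) = fun Q => ∑ i ∈ s, algD A (F i) Q := by
  funext Q
  have hFd : ∀ i ∈ s, DifferentiableAt ℝ (F i) Q := fun i hi => (hF i hi).differentiable (by simp) Q
  simp only [algD]
  rw [fderiv_fun_sum hFd, _root_.sum_apply]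

/-- **Leibniz rule** `D_A (F G) = F D_A G + G D_A F`. [folklore] -/
theorem algD_mul {F G : 𝔸 → ℝ} (hF : ContDiff ℝ ∞ F) (hG : ContDiff ℝ ∞ G) (A : 𝔸) :
    algD A (F * G) = F * algD A G + G * algD A F := by
  funext Q
  have hFd : DifferentiableAt ℝ F Q := hF.differentiable (by simp) Q
  have hGd : DifferentiableAt ℝ G Q := hG.differentiable (by simp) Q
  simp only [algD, Pi.mul_apply, Pi.add_apply]
  rw [fderiv_mul hFd hGd]
  simp only [_root_.add_apply, FunLike.coe_smul, Pi.smul_apply, smul_eq_mul]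

/-- Leibniz rule, lambda form. [folklore] -/
theorem algD_fun_mul {F G : 𝔸 → ℝ} (hF : ContDiff ℝ ∞ F) (hG : ContDiff ℝ ∞ G) (A : 𝔸) :
    algD A (fun Q => F Q * G Q) = fun Q => F Q * algD A G Q + G Q * algD A F Q :=
  algD_mul hF hG A

/-- Additivity, lambda form. [folklore] -/
theorem algD_fun_add {F G : 𝔸 → ℝ} (hF : ContDiff ℝ ∞ F) (hG : ContDiff ℝ ∞ G) (A : 𝔸) :
    algD A (fun Q => F Q + G Q) = fun Q => algD A F Q + algD A G Q :=
  algD_add hF hG A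

/-- **Chain rule** with a smooth real function: `D_A (h ∘ F) = h'(F) D_A F`. [folklore] -/
theorem algD_comp {F : 𝔸 → ℝ} (hF : ContDiff ℝ ∞ F) {h : ℝ → ℝ} (hh : ContDiff ℝ ∞ h) (A : 𝔸) :
    algD A (fun Q => h (F Q)) = fun Q => deriv h (F Q) * algD A F Q := by
  funext Q
  have hFd : DifferentiableAt ℝ F Q := hF.differentiable (by simp) Q
  have hhd : DifferentiableAt ℝ h (F Q) := hh.differentiable (by simp) _
  have hc := (hhd.hasDerivAt.comp_hasFDerivAt Q hFd.hasFDerivAt).fderiv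
  simp only [algD]
  rw [show (fun Q => h (F Q)) = h ∘ F from rfl, hc]
  simp only [FunLike.coe_smul, Pi.smul_apply, smul_eq_mul]

/-- `D_A e^{F} = e^{F} D_A F`. [folklore] -/
theorem algD_exp {F : 𝔸 → ℝ} (hF : ContDiff ℝ ∞ F) (A : 𝔸) :
    algD A (fun Q => Real.exp (F Q)) = fun Q => Real.exp (F Q) * algD A F Q := by
  rw [algD_comp hF Real.contDiff_exp]
  simp only [Real.deriv_exp]

/-! #### Linearity in the direction -/

/-- `D_{A+B} = D_A + D_B`. [folklore] -/
theorem algD_add_dir (A B : 𝔸) (F : 𝔸 → ℝ) : algD (A + B) F = algD A F + algD B F := by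
  funext Q
  simp only [algD, Pi.add_apply, mul_add, map_add]

/-- `D_{-A} = -D_A`. [folklore] -/
theorem algD_neg_dir (A : 𝔸) (F : 𝔸 → ℝ) : algD (-A) F = -algD A F := by
  funext Q
  simp only [algD, Pi.neg_apply, mul_neg, map_neg]

/-- `D_{A-B} = D_A - D_B`. [folklore] -/
theorem algD_sub_dir (A B : 𝔸) (F : 𝔸 → ℝ) : algD (A - B) F = algD A F - algD B F := by
  rw [sub_eq_add_neg, algD_add_dir, algD_neg_dir, ← sub_eq_add_neg]

/-- `D_{r A} = r D_A` for real `r`. [folklore] -/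
theorem algD_smul_dir (r : ℝ) (A : 𝔸) (F : 𝔸 → ℝ) : algD (r • A) F = r • algD A F := by
  funext Q
  simp only [algD, Pi.smul_apply, mul_smul_comm, map_smul]

/-- `D_{∑ rᵢ Aᵢ} = ∑ rᵢ D_{Aᵢ}`. [folklore] -/
theorem algD_sum_smul_dir {κ : Type*} (s : Finset κ) (r : κ → ℝ) (A : κ → 𝔸) (F : 𝔸 → ℝ) (Q : 𝔸) :
    algD (∑ i ∈ s, r i • A i) F Q = ∑ i ∈ s, r i * algD (A i) F Q := by
  simp only [algD, Finset.mul_sum, mul_smul_comm, map_sum, map_smul, smul_eq_mul]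

/-- `D_{∑ Aᵢ} = ∑ D_{Aᵢ}`. [folklore] -/
theorem algD_sum_dir {κ : Type*} (s : Finset κ) (A : κ → 𝔸) (F : 𝔸 → ℝ) (Q : 𝔸) :
    algD (∑ i ∈ s, A i) F Q = ∑ i ∈ s, algD (A i) F Q := by
  simp only [algD, Finset.mul_sum, map_sum]

/-! #### The derivative as a linear functional of the direction -/

/-- `A ↦ (D_A F)(Q)` as a real linear functional on `𝔸`. [folklore] -/
def dirFun (F : 𝔸 → ℝ) (Q : 𝔸) : 𝔸 →ₗ[ℝ] ℝ :=
  (fderiv ℝ F Q).toLinearMap.comp (LinearMap.mulLeft ℝ Q)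

/-- `dirFun F Q A = D_A F Q`. [folklore] -/
@[simp] theorem dirFun_apply (F : 𝔸 → ℝ) (Q A : 𝔸) : dirFun F Q A = algD A F Q := rfl

/-- For an `M`-Lipschitz function: `|D_A F(Q)| ≤ M ‖Q A‖`. [folklore] -/
theorem abs_algD_le_of_lipschitz {F : 𝔸 → ℝ} {M : NNReal} (hF : LipschitzWith M F) (Q A : 𝔸) :
    |algD A F Q| ≤ M * ‖Q * A‖ := by
  rw [algD_apply, ← Real.norm_eq_abs]
  calc ‖fderiv ℝ F Q (Q * A)‖ ≤ ‖fderiv ℝ F Q‖ * ‖Q * A‖ := ContinuousLinearMap.le_opNorm _ _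
    _ ≤ M * ‖Q * A‖ := mul_le_mul_of_nonneg_right (norm_fderiv_le_of_lipschitz ℝ hF) (norm_nonneg _)

/-! #### Continuous linear functions -/

/-- `D_A ℓ = ℓ(· A)` for a continuous linear `ℓ`. [folklore] -/
theorem algD_clm (ℓ : 𝔸 →L[ℝ] ℝ) (A : 𝔸) : algD A (fun Q => ℓ Q) = fun Q => ℓ (Q * A) := by
  funext Q
  change fderiv ℝ ℓ Q (Q * A) = _
  rw [ℓ.fderiv]

/-! #### The commutator identity -/

/-- Derivative of `Q ↦ Q B`. [folklore] -/
theorem hasFDerivAt_mul_const (B Q : 𝔸) :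
    HasFDerivAt (fun Q : 𝔸 => Q * B) (ContinuousLinearMap.mulLeftRight ℝ 𝔸 1 B) Q := by
  have : (fun Q : 𝔸 => Q * B) = fun Q => ContinuousLinearMap.mulLeftRight ℝ 𝔸 1 B Q := by
    funext Q; simp
  rw [this]
  exact (ContinuousLinearMap.mulLeftRight ℝ _ 1 B).hasFDerivAt

/-- **Commutator of left-invariant derivatives**: `[D_A, D_B] = D_{[A,B]}` (symmetry of second
derivatives). [folklore] -/
theorem algD_comm {F : 𝔸 → ℝ} (hF : ContDiff ℝ ∞ F) (A B : 𝔸) :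
    algD A (algD B F) - algD B (algD A F) = algD (A * B - B * A) F := by
  funext Q
  have hsymm : IsSymmSndFDerivAt ℝ F Q :=
    (hF.contDiffAt).isSymmSndFDerivAt (n := ∞)
      (by rw [minSmoothness_of_isRCLikeNormedField]; exact WithTop.coe_le_coe.2 le_top)
  have h1 : ContDiff ℝ ∞ (fderiv ℝ F) := hF.fderiv_right (m := ∞) le_rfl
  have hd1 : DifferentiableAt ℝ (fderiv ℝ F) Q := h1.differentiable (by simp) Q
  have key : ∀ (B C : 𝔸),
      fderiv ℝ (fun Q => fderiv ℝ F Q (Q * B)) Q C =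
        fderiv ℝ (fderiv ℝ F) Q C (Q * B) + fderiv ℝ F Q (C * B) := by
    intro B C
    have hu : DifferentiableAt ℝ (fun Q : 𝔸 => Q * B) Q := (hasFDerivAt_mul_const B Q).differentiableAt
    rw [fderiv_clm_apply hd1 hu]
    simp only [_root_.add_apply, ContinuousLinearMap.comp_apply, ContinuousLinearMap.flip_apply]
    rw [(hasFDerivAt_mul_const B Q).fderiv]
    simp only [ContinuousLinearMap.mulLeftRight_apply, one_mul]
    rw [add_comm]
  simp only [Pi.sub_apply]
  unfold algD
  rw [key B (Q * A), key A (Q * B), hsymm (Q * A) (Q * B)]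
  simp only [mul_sub, mul_assoc, map_sub]
  ring

/-! #### Derivative along one-parameter subgroups -/

section Flow

variable [CompleteSpace 𝔸]

omit [CompleteSpace 𝔸] in
/-- `exp(tA)` commutes with `A`. [folklore] -/
theorem exp_smul_mul_self (A : 𝔸) (t : ℝ) :
    A * NormedSpace.exp (t • A) = NormedSpace.exp (t • A) * A :=
  ((Commute.refl A).smul_right t).exp_right.eq

/-- **Derivative along the flow**: `d/dt F(Q e^{tA}) = (D_A F)(Q e^{tA})`. [folklore] -/
theorem hasDerivAt_comp_mul_exp {F : 𝔸 → ℝ} (hF : ContDiff ℝ ∞ F) (Q A : 𝔸) (t : ℝ) :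
    HasDerivAt (fun s : ℝ => F (Q * NormedSpace.exp (s • A)))
      (algD A F (Q * NormedSpace.exp (t • A))) t := by
  have h1 : HasDerivAt (fun s : ℝ => Q * NormedSpace.exp (s • A))
      (Q * (A * NormedSpace.exp (t • A))) t :=
    (hasDerivAt_exp_smul_const' (𝕂 := ℝ) A t).const_mul Q
  have hFd : DifferentiableAt ℝ F (Q * NormedSpace.exp (t • A)) := hF.differentiable (by simp) _
  have h2 := hFd.hasFDerivAt.comp_hasDerivAt t h1
  have h3 : fderiv ℝ F (Q * NormedSpace.exp (t • A)) (Q * (A * NormedSpace.exp (t • A))) =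
      algD A F (Q * NormedSpace.exp (t • A)) := by
    rw [algD_apply, exp_smul_mul_self, mul_assoc]
  rw [h3] at h2
  exact h2

/-- **Second derivative along the flow at `t = 0`**: the second derivative of
`t ↦ F(Q e^{tA})` at `0` is `(D_A D_A F)(Q)`. [folklore] -/
theorem iteratedDeriv_two_comp_mul_exp {F : 𝔸 → ℝ} (hF : ContDiff ℝ ∞ F) (Q A : 𝔸) :
    iteratedDeriv 2 (fun s : ℝ => F (Q * NormedSpace.exp (s • A))) 0 = algD A (algD A F) Q := by
  have h1 : deriv (fun s : ℝ => F (Q * NormedSpace.exp (s • A))) =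
      fun s => algD A F (Q * NormedSpace.exp (s • A)) :=
    funext fun s => (hasDerivAt_comp_mul_exp hF Q A s).deriv
  rw [iteratedDeriv_succ, iteratedDeriv_one, h1, (hasDerivAt_comp_mul_exp (contDiff_algD hF A) Q A 0).deriv,
    zero_smul, NormedSpace.exp_zero, mul_one]

/-- If `D_A F` vanishes along the curve `t ↦ Q e^{tA}`, then `F(Q e^{A}) = F(Q)`. [folklore] -/
theorem apply_mul_exp_eq_of_algD_eq_zero {F : 𝔸 → ℝ} (hF : ContDiff ℝ ∞ F) (Q A : 𝔸)
    (h : ∀ t : ℝ, algD A F (Q * NormedSpace.exp (t • A)) = 0) :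
    F (Q * NormedSpace.exp A) = F Q := by
  have hderiv : ∀ t, HasDerivAt (fun s : ℝ => F (Q * NormedSpace.exp (s • A))) 0 t := by
    intro t
    have h' := hasDerivAt_comp_mul_exp hF Q A t
    rwa [h t] at h'
  have hconst := is_const_of_deriv_eq_zero (fun t => (hderiv t).differentiableAt)
    (fun t => (hderiv t).deriv) 1 0
  simp only [one_smul, zero_smul, NormedSpace.exp_zero, mul_one] at hconst
  exact hconst

end Flow

end LatticeBakryEmery

end Summit.Ventures.YMGap
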